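import Summits.CriticalPhenomena.CardyFormulaZ2.Theses.CardyIKTransport
import Literature.Probability.LatticeModels.LatticeGraph

/-!
# `RenewalGridHarmless` (stmt-CriticalPhenomena-4967), sandwich step 5: an asymptotically
# homogeneous product grid is an `o(1)` distortion of the homothetic square grid on bounded windows

Route `CardyIKTransport`, support item `RenewalGridHarmless`. If `s i / i → a > 0` as `|i| → ∞`
(`Filter.cocompact ℤ`), then for every window size `C` and precision `κ` there is `δ₀ > 0` such
that for all meshes `0 < δ' < δ₀` and all `i` with `|δ' s i| ≤ C` one has
`|δ' s i - δ' a i| ≤ κ` (`exists_delta_abs_sub_le`): for the finitely many `i` where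
`|s i / i - a| ≥ θ` this is smallness of `δ'`, elsewhere `|s i - a i| < θ |i| ≤ (2θ/a) |s i|`.
The two-coordinate version `exists_delta_norm_sub_le` compares the product grid
`δ' (s v₀ + i t v₁)` with the square grid `δ' a (v₀ + i v₁)` in sup over the window. Elementary
real analysis; no percolation.
-/

noncomputable section

namespace Summit.CriticalPhenomena.CardyFormulaZ2.Theorems.CardyIKTransport.RenewalGridHarmless

open Filter Set Metric
open scoped Topology
open Literature.Probability.LatticeModels

/-- **One-dimensional distortion control.** See the module docstring. [folklore] -/
theorem exists_delta_abs_sub_le {s : ℤ → ℝ} {a : ℝ} (ha : 0 < a)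
    (hs : Tendsto (fun i : ℤ => s i / (i : ℝ)) (cocompact ℤ) (𝓝 a)) {C κ : ℝ} (hC : 0 < C)
    (hκ : 0 < κ) :
    ∃ δ₀ > 0, ∀ δ' : ℝ, 0 < δ' → δ' < δ₀ → ∀ i : ℤ, |δ' * s i| ≤ C →
      |δ' * s i - δ' * a * i| ≤ κ := by
  classical
  set θ : ℝ := min (a / 2) (κ * a / (4 * C)) with hθ
  have hθpos : 0 < θ := lt_min (by linarith) (by positivity)
  have hθa : θ ≤ a / 2 := min_le_left _ _
  have hθκ : θ ≤ κ * a / (4 * C) := min_le_right _ _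
  have hev : ∀ᶠ i : ℤ in cocompact ℤ, dist (s i / (i : ℝ)) a < θ :=
    hs.eventually (Metric.ball_mem_nhds a hθpos)
  rw [cocompact_eq_cofinite, Filter.eventually_cofinite] at hev
  set F : Finset ℤ := hev.toFinset ∪ {0} with hF
  set M : ℝ := ∑ i ∈ F, |s i - a * i| with hM
  have hM0 : 0 ≤ M := Finset.sum_nonneg fun i _ => abs_nonneg _
  refine ⟨κ / (M + 1), by positivity, fun δ' hδ' hδ'lt i hi => ?_⟩
  have e : δ' * s i - δ' * a * i = δ' * (s i - a * i) := by ring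
  rw [e, abs_mul, abs_of_pos hδ']
  by_cases hiF : i ∈ F
  · -- finitely many exceptional indices: smallness of `δ'`
    have h1 : |s i - a * i| ≤ M := by
      rw [hM]
      exact Finset.single_le_sum (f := fun j => |s j - a * j|) (fun j _ => abs_nonneg _) hiF
    have h2 : δ' * |s i - a * i| ≤ κ / (M + 1) * M :=
      mul_le_mul hδ'lt.le h1 (abs_nonneg _) (by positivity)
    have h3 : κ / (M + 1) * M ≤ κ := by
      rw [div_mul_eq_mul_div, div_le_iff₀ (by positivity)]
      nlinarith
    linarith
  · -- generic indices: `|s i - a i| < θ |i| ≤ (2θ/a) |s i|`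
    have hi0 : i ≠ 0 := by
      intro h; apply hiF; rw [hF, h]; simp
    have hgood : dist (s i / (i : ℝ)) a < θ := by
      by_contra h
      apply hiF
      rw [hF, Finset.mem_union]
      exact Or.inl (hev.mem_toFinset.2 h)
    have hir : (i : ℝ) ≠ 0 := by exact_mod_cast hi0
    have hipos : 0 < |(i : ℝ)| := abs_pos.2 hir
    rw [Real.dist_eq] at hgood
    have h1 : |s i - a * i| < θ * |(i : ℝ)| := by
      have e2 : s i - a * i = (s i / i - a) * i := by field_simp
      rw [e2, abs_mul]
      exact mul_lt_mul_of_pos_right hgood hipos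
    -- `|i| ≤ (2/a) |s i|`
    have h2 : a / 2 * |(i : ℝ)| ≤ |s i| := by
      have : |a * i| ≤ |s i| + |s i - a * i| := by
        have := abs_sub_abs_le_abs_sub (a * i) (s i)
        rw [abs_sub_comm] at this; linarith
      rw [abs_mul, abs_of_pos ha] at this
      nlinarith
    -- `δ' |s i| ≤ C`
    rw [abs_mul, abs_of_pos hδ'] at hi
    have h3 : δ' * |s i - a * i| ≤ δ' * (θ * |(i : ℝ)|) := mul_le_mul_of_nonneg_left h1.le hδ'.le
    have h4 : δ' * (θ * |(i : ℝ)|) ≤ θ * (2 / a) * C := by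
      have : θ * |(i : ℝ)| ≤ θ * (2 / a) * |s i| := by
        rw [mul_assoc]
        refine mul_le_mul_of_nonneg_left ?_ hθpos.le
        rw [div_mul_eq_mul_div, le_div_iff₀ ha]; nlinarith
      calc δ' * (θ * |(i : ℝ)|) ≤ δ' * (θ * (2 / a) * |s i|) := mul_le_mul_of_nonneg_left this hδ'.le
        _ = θ * (2 / a) * (δ' * |s i|) := by ring
        _ ≤ θ * (2 / a) * C := mul_le_mul_of_nonneg_left hi (by positivity)
    have h5 : θ * (2 / a) * C ≤ κ / 2 := by
      have := mul_le_mul_of_nonneg_right hθκ (show 0 ≤ 2 / a * C by positivity)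
      calc θ * (2 / a) * C = θ * (2 / a * C) := by ring
        _ ≤ κ * a / (4 * C) * (2 / a * C) := this
        _ = κ / 2 := by field_simp; ring
    linarith

/-- Components of a real multiple of `⟨x, y⟩`. [folklore] -/
theorem re_im_ofReal_mul_mk (δ x y : ℝ) :
    ((δ : ℂ) * (⟨x, y⟩ : ℂ)).re = δ * x ∧ ((δ : ℂ) * (⟨x, y⟩ : ℂ)).im = δ * y := by
  constructor <;> simp [Complex.mul_re, Complex.mul_im]

/-- **Two-dimensional distortion control**: on windows `‖δ' (s v₀ + i t v₁)‖ ≤ C` the product grid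
is `κ`-close to the square grid `δ' a (v₀ + i v₁)`, for all small meshes `δ'`. [folklore] -/
theorem exists_delta_norm_sub_le {s t : ℤ → ℝ} {a : ℝ} (ha : 0 < a)
    (hs : Tendsto (fun i : ℤ => s i / (i : ℝ)) (cocompact ℤ) (𝓝 a))
    (ht : Tendsto (fun i : ℤ => t i / (i : ℝ)) (cocompact ℤ) (𝓝 a)) {C κ : ℝ} (hC : 0 < C)
    (hκ : 0 < κ) :
    ∃ δ₀ > 0, ∀ δ' : ℝ, 0 < δ' → δ' < δ₀ → ∀ v : Site 2,
      ‖(δ' : ℂ) * (⟨s (v 0), t (v 1)⟩ : ℂ)‖ ≤ C →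
        ‖(δ' : ℂ) * (⟨s (v 0), t (v 1)⟩ : ℂ) - ((δ' * a : ℝ) : ℂ) * Site.toComplex v‖ ≤ κ := by
  obtain ⟨δ₁, hδ₁, h1⟩ := exists_delta_abs_sub_le ha hs hC (half_pos hκ)
  obtain ⟨δ₂, hδ₂, h2⟩ := exists_delta_abs_sub_le ha ht hC (half_pos hκ)
  refine ⟨min δ₁ δ₂, lt_min hδ₁ hδ₂, fun δ' hδ' hδ'lt v hv => ?_⟩
  obtain ⟨hre, him⟩ := re_im_ofReal_mul_mk δ' (s (v 0)) (t (v 1))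
  have hs' : |δ' * s (v 0)| ≤ C := by
    rw [← hre]; exact (Complex.abs_re_le_norm _).trans hv
  have ht' : |δ' * t (v 1)| ≤ C := by
    rw [← him]; exact (Complex.abs_im_le_norm _).trans hv
  have k1 := h1 δ' hδ' (hδ'lt.trans_le (min_le_left _ _)) (v 0) hs'
  have k2 := h2 δ' hδ' (hδ'lt.trans_le (min_le_right _ _)) (v 1) ht'
  refine (Complex.norm_le_abs_re_add_abs_im _).trans ?_
  have ere : ((δ' : ℂ) * (⟨s (v 0), t (v 1)⟩ : ℂ) - ((δ' * a : ℝ) : ℂ) * Site.toComplex v).re =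
      δ' * s (v 0) - δ' * a * (v 0 : ℝ) := by
    simp [Complex.mul_re, Site.toComplex]
  have eim : ((δ' : ℂ) * (⟨s (v 0), t (v 1)⟩ : ℂ) - ((δ' * a : ℝ) : ℂ) * Site.toComplex v).im =
      δ' * t (v 1) - δ' * a * (v 1 : ℝ) := by
    simp [Complex.mul_im, Site.toComplex]
  rw [ere, eim]
  linarith

end Summit.CriticalPhenomena.CardyFormulaZ2.Theorems.CardyIKTransport.RenewalGridHarmless

end
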